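import Summits.ABC.StewartYu.ArchShapeOneSub
import HarnessLib

/-!
# Cell abc-stewartyu — draft route `YuMatveevShapeRat` (plan-m3 g2, HOME/plan-m3/next/SketchGA.lean):
# the support item `ArchShapeChain : ArchCoreRat → ArchHalf`, PROVED

Cell `abc-stewartyu` (HOME `run/shared/lean/pub/abc-stewartyu/`; seat `lit-abc-yu2007` g3). Theorems only;
no definition, no named fact, nothing closed (the route is a draft, not opened). `archHalf_of_archCoreRat`
is the planner's `ArchShapeChain` with both definitions unfolded, texts verbatim: from the archimedean
SHAPE core over `ℚ` (`∃ c`: independent positive rationals, `log|∑ bᵢ log aᵢ| ≥ −cʳ ∏Aᵢ log(eB)`) to the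
archimedean half of the library rung "A1.L" (`∃ K ≥ 1`: for `ξᵢ ∈ ℚ ∖ {0, ±1}`, `ζ = ±1`,
`Ξ = ζ∏ξᵢ^{bᵢ} ≠ 1`: `log|1 − Ξ| > −K^{#ι} log max(e, h(Ξ)) ∏ h(ξᵢ)`). Chain: dependence removal
(`archShape_dep_of_indep`, Matveev §21 in shape currency) → signs and `|Λ|` versus `|1 − Ξ|`
(`archShape_oneSub_of_indep`) → HERE: Evertse–Győry §4.4.2 at the infinite place with `α = 1`: choose a
system of generators with small exponents (`exists_small_exponents` = Prop. 4.4.1 over `ℚ`, PROVED in the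
tree: `Ξ = ζ'∏ξ'ᵢ^{b'ᵢ}`, `∏h(ξ'ᵢ) ≤ ∏h(ξᵢ)`, `|b'ᵢ| ≤ m^{2m} h(Ξ)/log 2`), take `Aᵢ = h(ξ'ᵢ)/log 2 ≥ 1`,
`B = max{1, m^{2m}h(Ξ)/log 2}`, so that `∏Aᵢ ≤ ∏h(ξᵢ)/(log 2)^m` and
`log(eB) ≤ 1.37 + 2m² + log max(e,h(Ξ)) ≤ 9^m log max(e,h(Ξ))`; `K = 9 max(|c'|,1)/log 2 + 1`. In this
currency no Case A/B distinction is needed at the infinite place (there is no `A_max` term).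
WHAT THIS IS NOT: the crux `ArchCoreRat` (an archimedean Gen-3 engine over `ℚ` with constant `cⁿ`) is NOT
proved; no route item is closed (draft); no abc claim. References: [EvertseGyory2015] Prop. 4.4.1, §4.4.2
(pp. 80–81); [Matveev2000] §21; [Nesterenko2003] Thm. 2.1/2.2.
-/

open Height Real Finset
open Literature.NumberTheory.DiophantineGeometry.Dioph

noncomputable section

namespace Summit.ABC.StewartYu

namespace ArchShapeChainProof

/-- `2m² + 3 ≤ 9^m` for `m ≥ 1`. [folklore] -/
private theorem two_mul_sq_add_three_le (m : ℕ) (hm : 1 ≤ m) : 2 * (m : ℝ) ^ 2 + 3 ≤ (9 : ℝ) ^ m := by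
  have key : ∀ n : ℕ, 2 * (n + 1) ^ 2 + 3 ≤ 9 ^ (n + 1) := by
    intro n
    induction n with
    | zero => norm_num
    | succ k ih =>
      have : 2 * (k + 1 + 1) ^ 2 + 3 ≤ 9 * (2 * (k + 1) ^ 2 + 3) := by nlinarith
      calc 2 * (k + 1 + 1) ^ 2 + 3 ≤ 9 * (2 * (k + 1) ^ 2 + 3) := this
        _ ≤ 9 * 9 ^ (k + 1) := Nat.mul_le_mul_left 9 ih
        _ = 9 ^ (k + 1 + 1) := by ring
  obtain ⟨n, rfl⟩ : ∃ n, m = n + 1 := ⟨m - 1, by omega⟩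
  have := key n
  exact_mod_cast this

end ArchShapeChainProof

open ArchShapeChainProof in
/-- **`ArchShapeChain` of the draft route `YuMatveevShapeRat`, proved**: the planner's `ArchCoreRat` text
implies the planner's `ArchHalf` text (both verbatim, definitions unfolded). Evertse–Győry §4.4.2 at the
infinite place with `α = 1` on top of `archShape_oneSub_of_indep` and `exists_small_exponents`.
[cite: EvertseGyory2015, Prop 4.4.1 and §4.4.2 (pp. 80–81)] -/
theorem archHalf_of_archCoreRat
    (h : ∃ c : ℝ, ∀ (r : ℕ) (a : Fin r → ℚ) (b : Fin r → ℤ) (A : Fin r → ℝ) (B : ℝ),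
      (∀ i, 0 < a i) →
      (∀ μ : Fin r → ℤ, ∏ i, a i ^ μ i = 1 → μ = 0) →
      (∀ i, Height.logHeight₁ (a i) ≤ A i) → (∀ i, 1 ≤ A i) →
      b ≠ 0 → (∀ i, (|b i| : ℝ) ≤ B) →
      -(c ^ r * (∏ i, A i) * Real.log (Real.exp 1 * B)) ≤
        Real.log |∑ i, (b i : ℝ) * Real.log (a i : ℝ)|) :
    ∃ K : ℝ, 1 ≤ K ∧ ∀ (ι : Type) [Fintype ι], 0 < Fintype.card ι → ∀ ξ : ι → ℚ,
      (∀ i, ξ i ≠ 0 ∧ ξ i ≠ 1 ∧ ξ i ≠ -1) → ∀ ζ : ℚ, (ζ = 1 ∨ ζ = -1) → ∀ b : ι → ℤ,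
      ζ * ∏ i, ξ i ^ b i ≠ 1 →
        -(K ^ Fintype.card ι * Real.log (max (Real.exp 1) (Height.logHeight₁ (ζ * ∏ i, ξ i ^ b i))) *
            ∏ i, Height.logHeight₁ (ξ i)) <
          Real.log |1 - ((ζ * ∏ i, ξ i ^ b i : ℚ) : ℝ)| := by
  obtain ⟨c, hc⟩ := archShape_oneSub_of_indep h
  set c₁ := max |c| 1 with hc₁
  have hc₁1 : 1 ≤ c₁ := le_max_right _ _
  have hlog2 : 0 < Real.log 2 := Real.log_pos one_lt_two
  have hl2 : Real.log 2 < 1 := by have := Real.log_two_lt_d9; linarith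
  have hl2' : (1 / 2 : ℝ) < Real.log 2 := by have := Real.log_two_gt_d9; linarith
  set K₀ := 9 * c₁ / Real.log 2 with hK₀
  have hK₀1 : 1 ≤ K₀ := by
    rw [hK₀, le_div_iff₀ hlog2]; nlinarith
  refine ⟨K₀ + 1, by linarith, ?_⟩
  intro ι _ hι ξ hξ ζ hζ b hΞ1
  classical
  set m := Fintype.card ι with hm
  have hm1 : 1 ≤ m := hι
  set Ξ : ℚ := ζ * ∏ i, ξ i ^ b i with hΞ
  set Y := Real.log (max (Real.exp 1) (logHeight₁ Ξ)) with hY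
  have hE := Real.exp_pos 1
  have hY1 : 1 ≤ Y := by
    rw [hY, ← Real.log_exp 1]
    exact Real.log_le_log hE (by rw [Real.log_exp]; exact le_max_left _ _)
  have hYh : Real.log (logHeight₁ Ξ) ≤ Y := by
    by_cases h0 : 0 < logHeight₁ Ξ
    · exact Real.log_le_log h0 (le_max_right _ _)
    · push Not at h0
      have : logHeight₁ Ξ = 0 := le_antisymm h0 (Height.zero_le_logHeight₁ _)
      rw [this, Real.log_zero]; linarith
  -- small exponents (Prop. 4.4.1)
  obtain ⟨ξ', ζ', b', hξ', hζ', hΞeq, hprodh, hb'⟩ := exists_small_exponents hι ξ hξ ζ hζ b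
  have hhξ' : ∀ i, Real.log 2 ≤ logHeight₁ (ξ' i) := fun i =>
    log_two_le_logHeight₁ (hξ' i).1 (hξ' i).2.1 (hξ' i).2.2
  have hhξ : ∀ i, Real.log 2 ≤ logHeight₁ (ξ i) := fun i =>
    log_two_le_logHeight₁ (hξ i).1 (hξ i).2.1 (hξ i).2.2
  have hΘpos : 0 < ∏ i, logHeight₁ (ξ i) := Finset.prod_pos fun i _ => lt_of_lt_of_le hlog2 (hhξ i)
  -- transport to `Fin m`
  set e : ι ≃ Fin m := Fintype.equivFin ι with he
  set ξf : Fin m → ℚ := fun j => ξ' (e.symm j) with hξf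
  set bf : Fin m → ℤ := fun j => b' (e.symm j) with hbf
  set Af : Fin m → ℝ := fun j => logHeight₁ (ξf j) / Real.log 2 with hAf
  set X := (m : ℝ) ^ (2 * m) * logHeight₁ Ξ / Real.log 2 with hX
  set B := max 1 X with hB
  have hB1 : 1 ≤ B := le_max_left _ _
  have hprodf : ζ' * ∏ j, ξf j ^ bf j = Ξ := by
    rw [hΞ, hΞeq]
    congr 1
    exact Fintype.prod_equiv e.symm (fun j => ξf j ^ bf j) (fun i => ξ' i ^ b' i) fun j => rfl
  have hone := hc m ξf bf Af B ζ' hζ' (fun j => (hξ' _).1)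
    (fun j => by
      rw [hAf]; dsimp only
      rw [le_div_iff₀ hlog2]
      nlinarith [Height.zero_le_logHeight₁ (ξf j)])
    (fun j => by rw [hAf]; dsimp only; rw [le_div_iff₀ hlog2, one_mul]; exact hhξ' _)
    (fun j => (hb' (e.symm j)).trans (by rw [hB, hX, hm]; exact le_max_right _ _)) hB1
    (by rw [hprodf]; exact hΞ1)
  rw [hprodf] at hone
  -- `∏ Af ≤ ∏ h(ξ) / (log 2)^m`
  have hAprod : ∏ j, Af j = (∏ i, logHeight₁ (ξ' i)) / Real.log 2 ^ m := by
    rw [hAf]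
    dsimp only
    rw [Finset.prod_div_distrib, Finset.prod_const, card_univ, Fintype.card_fin]
    congr 1
    exact Fintype.prod_equiv e.symm (fun j => logHeight₁ (ξf j)) (fun i => logHeight₁ (ξ' i)) fun j => rfl
  have hAle : ∏ j, Af j ≤ (∏ i, logHeight₁ (ξ i)) / Real.log 2 ^ m := by
    rw [hAprod]; exact div_le_div_of_nonneg_right hprodh (by positivity)
  have hA0 : 0 ≤ ∏ j, Af j := by rw [hAprod]; positivity
  -- `log(eB) ≤ 9^m Y`
  have hmR : (1 : ℝ) ≤ m := by exact_mod_cast hm1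
  have hlogm : Real.log m ≤ (m : ℝ) := by
    have := Real.log_le_sub_one_of_pos (show (0 : ℝ) < m by linarith); linarith
  have hLB : Real.log (Real.exp 1 * B) ≤ (9 : ℝ) ^ m * Y := by
    rw [Real.log_mul hE.ne' (by linarith), Real.log_exp]
    have h9 := two_mul_sq_add_three_le m hm1
    have hlogB : Real.log B ≤ 2 * (m : ℝ) ^ 2 + 1 + Y := by
      by_cases hX1 : X ≤ 1
      · have : B = 1 := by rw [hB]; exact max_eq_left hX1
        rw [this, Real.log_one]; nlinarith
      · push Not at hX1
        have hBX : B = X := by rw [hB]; exact max_eq_right hX1.le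
        have hh0 : 0 < logHeight₁ Ξ := by
          by_contra h0; push Not at h0
          have : X ≤ 0 := by
            rw [hX]; exact div_nonpos_of_nonpos_of_nonneg
              (mul_nonpos_of_nonneg_of_nonpos (by positivity) h0) hlog2.le
          linarith
        rw [hBX, hX, Real.log_div (by positivity) hlog2.ne', Real.log_mul (by positivity) hh0.ne',
          Real.log_pow]
        have h1 : Real.log (Real.log 2) ≥ -1 := by
          rw [ge_iff_le, ← Real.log_exp (-1)]
          refine Real.log_le_log (Real.exp_pos _) ?_
          have : Real.exp (-1) < 1 / 2 := by
            rw [Real.exp_neg, inv_lt_comm₀ hE (by norm_num)]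
            have := Real.exp_one_gt_d9; norm_num; linarith
          linarith
        have h2 : ((2 * m : ℕ) : ℝ) * Real.log m ≤ 2 * (m : ℝ) ^ 2 := by
          push_cast; nlinarith
        linarith
    calc 1 + Real.log B ≤ 2 * (m : ℝ) ^ 2 + 2 + Y := by linarith
      _ ≤ (2 * (m : ℝ) ^ 2 + 3) * Y := by nlinarith
      _ ≤ (9 : ℝ) ^ m * Y := mul_le_mul_of_nonneg_right h9 (by linarith)
  -- assemble: `c^m ∏Af log(eB) ≤ c₁^m (∏h/(log 2)^m) 9^m Y = K₀^m ∏h Y < (K₀+1)^m Y ∏h`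
  have hLB0 : 0 ≤ Real.log (Real.exp 1 * B) := by
    rw [Real.log_mul hE.ne' (by linarith), Real.log_exp]; linarith [Real.log_nonneg hB1]
  have hcm : c ^ m ≤ c₁ ^ m :=
    le_trans (by rw [← abs_pow]; exact le_abs_self _) (pow_le_pow_left₀ (abs_nonneg c) (le_max_left _ _) m)
  have h1 : c ^ m * (∏ j, Af j) * Real.log (Real.exp 1 * B) ≤
      c₁ ^ m * ((∏ i, logHeight₁ (ξ i)) / Real.log 2 ^ m) * ((9 : ℝ) ^ m * Y) := by
    have hc₁0 : 0 ≤ c₁ ^ m := by positivity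
    calc c ^ m * (∏ j, Af j) * Real.log (Real.exp 1 * B)
        ≤ c₁ ^ m * (∏ j, Af j) * Real.log (Real.exp 1 * B) :=
          mul_le_mul_of_nonneg_right (mul_le_mul_of_nonneg_right hcm hA0) hLB0
      _ ≤ c₁ ^ m * ((∏ i, logHeight₁ (ξ i)) / Real.log 2 ^ m) * Real.log (Real.exp 1 * B) :=
          mul_le_mul_of_nonneg_right (mul_le_mul_of_nonneg_left hAle hc₁0) hLB0
      _ ≤ c₁ ^ m * ((∏ i, logHeight₁ (ξ i)) / Real.log 2 ^ m) * ((9 : ℝ) ^ m * Y) :=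
          mul_le_mul_of_nonneg_left hLB (by positivity)
  have h2 : c₁ ^ m * ((∏ i, logHeight₁ (ξ i)) / Real.log 2 ^ m) * ((9 : ℝ) ^ m * Y) =
      K₀ ^ m * Y * ∏ i, logHeight₁ (ξ i) := by
    rw [hK₀, div_pow, mul_pow]
    field_simp
  have h3 : K₀ ^ m * Y * ∏ i, logHeight₁ (ξ i) < (K₀ + 1) ^ m * Y * ∏ i, logHeight₁ (ξ i) := by
    have hK : K₀ ^ m < (K₀ + 1) ^ m :=
      pow_lt_pow_left₀ (by linarith) (by linarith) (by omega)
    have hYΘ : 0 < Y * ∏ i, logHeight₁ (ξ i) := mul_pos (by linarith) hΘpos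
    nlinarith
  linarith [hone, h1, h2.le, h2.ge, h3]

end Summit.ABC.StewartYu

end
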